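import Literature.Analysis.FluidPDE.ESSLocalHolderBlowupLocalEnergy
import Literature.Analysis.FluidPDE.SuitableWeakRightContinuity
import Literature.Analysis.FluidPDE.LocalLeraySolutionsSlab
import Literature.Analysis.FluidPDE.LocalEnergyTimeShift
import Literature.Analysis.FluidPDE.LerayHopfRestart
import Literature.Analysis.FluidPDE.LocalEnergySliceLEI
import HarnessLib

/-!
# ESS Thm. 1.4 (`ess_local_holder`): the blow-up limit, restarted at almost every time, is a
# local Leray solution on a slab with `L³` datum which vanishes at the final time

Analysis/FluidPDE proofs-only file (theorems only: no definitions, no named facts) in the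
bottom-up discharge of `Literature.Analysis.FluidPDE.ess_local_holder` (L. Escauriaza,
G. Seregin, V. Šverák, Russ. Math. Surveys 58:2 (2003) 211–250, Thm. 1.4) through
Lemarié-Rieusset's backward uniqueness theorem for local Leray solutions (the named fact
`lemarieRieusset_backward_uniqueness_slab`, *The Navier–Stokes Problem in the 21st Century*
(2016), Thm. 15.4). It assembles the hypotheses of that theorem for the blow-up limit `(w, π)`
of `exists_blowup_limit` (a local energy ancient solution in the sense of G. Seregin, *Lecture
Notes on Regularity Theory for the Navier–Stokes Equations* (2014), §6.6, with `L³` slices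
and vanishing weakly at the final time `s = 0`, `blowup_top_vanishing`):

* `exists_restart` — for every `T > 0` there are a time `s₀ ∈ ]-T, 0[` and a representative
  `W` of the translate `t ↦ w(s₀ + t)` (equal to it at every good time `s₀ + t`, i.e. off a
  null set of times) such that `(W, π(s₀ + ·))` is a local Leray solution on the slab
  `(0, -s₀) × ℝ³` with datum `w(s₀)` (the tree's `IsLocalLeraySolutionOn`, Lemarié-Rieusset's
  Def. 14.1 class with Kang–Miura–Tsai's clauses), the datum lies in `L³` and is weakly
  divergence free, the pairings `∫ ⟪W(t), φ⟫` tend to `0` as `t ↑ -s₀` for every test field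
  `φ`, and `W = 0` a.e. on the strip forces `w = 0` a.e. on `]s₀, 0[ × ℝ³`.

The time `s₀` is any time at which (i) the slices are strongly `L²_loc` right-continuous along
a full-measure set (`SuitableRestart.ae_tendsto_lintegral_ball_sub_sq`, the restart property:
Lemarié-Rieusset 2016, p. 568, "for almost every `T₃ ∈ (T₀, T₁)`, `u` is a local Leray solution
on `(T₃, T₁)`"), (ii) the slice is weakly divergence free
(`SuitableRestart.ae_isWeaklyDivFree_slice`) and (iii) the slice lies in `L³` with the sliced
bound (`ae_pressure_ae_eq_rieszPressure`); almost every `s₀ < 0` qualifies. The representative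
`W` modifies the translate only at the exceptional times (where it is set to `w(s₀)` in the first
half of the slab and to `0` in the second half), the usual modification on a null set of times
under which the class of suitable weak solutions is invariant (`IsSuitableWeakSolutionOn.congr_ae`);
the remaining clauses are those of `ESSLocalHolderBlowupLocalEnergy.lean`, translated in time.

Nothing accepted is restated or changed; no `sorry`.

## References

* L. Escauriaza, G. Seregin, V. Šverák, Russ. Math. Surveys 58:2 (2003) 211–250: Thm. 1.4, §3.
  [`EscauriazaSereginSverak2003`]
* P. G. Lemarié-Rieusset, *The Navier–Stokes Problem in the 21st Century* (2016), Def. 14.1,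
  Thm. 15.4 and its proof (PDF p. 568). [`LemarieRieusset2016`]
* G. Seregin, *Lecture Notes on Regularity Theory for the Navier–Stokes Equations* (2014), §6.6,
  Prop. 6.20, pp. 126–129; App. B, Remark B.4. [`Seregin2014`]
* K. Kang, H. Miura, T.-P. Tsai, IMRN 2021 = arXiv:1812.10509, Def. 3.2. [`KangMiuraTsai2020`]
-/

noncomputable section

open MeasureTheory Set Function Filter Topology TopologicalSpace Metric
open scoped NNReal ENNReal InnerProductSpace RealInnerProductSpace

namespace Literature.Analysis.FluidPDE

namespace ESSBlowup

variable {w : ℝ → EuclideanSpace ℝ (Fin 3) → EuclideanSpace ℝ (Fin 3)}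
  {π : ℝ → EuclideanSpace ℝ (Fin 3) → ℝ}

/-! ### The restart -/

/-- **The blow-up limit, restarted at almost every time, is a local Leray solution on a slab
with `L³` datum, vanishing at the final time** (the hypotheses of Lemarié-Rieusset 2016,
Thm. 15.4 = `lemarieRieusset_backward_uniqueness_slab`, for the local energy ancient solution
of Seregin 2014, Prop. 6.20 in the `L_{3,∞}` case, restarted as on p. 568 of Lemarié-Rieusset:
"for almost every `T₃`, `u` is a local Leray solution on `(T₃, T₁)`"). Let `(w, π)` be a
suitable weak solution on every `Q(a)` with the sliced bound `∫_{B(a)} |w(s)|³ ≤ M`, the pressure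
bound `D(a) ≤ D⋆`, `w ∈ L³(Q(a))`, whose pairings with test fields vanish essentially as
`s ↑ 0`. Then for every `T > 0` there are `s₀ ∈ ]-T, 0[` and `W : ℝ → ℝ³ → ℝ³` such that:
`(W, π(s₀ + ·))` is a local Leray solution on `(0, -s₀) × ℝ³` with datum `w(s₀)`
(`IsLocalLeraySolutionOn`); `w(s₀) ∈ L³` is weakly divergence free; `∫ ⟪W(t), φ⟫ → 0` as
`t ↑ -s₀` for every test field `φ`; and if `W = 0` a.e. on the strip then `w = 0` a.e. on
`]s₀, 0[ × ℝ³`. See the module docstring for the construction of `W`.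
[cite: LemarieRieusset2016, Thm. 15.4 and proof p. 568] [cite: Seregin2014, §6.6 Prop. 6.20] -/
theorem exists_restart {M D : ℝ≥0}
    (hw : ∀ a : ℝ, 0 < a → IsSuitableWeakSolutionInBall a (0 : ℝ × EuclideanSpace ℝ (Fin 3)) w π)
    (hM : ∀ a : ℝ, 0 < a → ∀ᵐ s ∂(volume.restrict (Ioo (-a ^ 2) 0)),
      ∫⁻ y in ball (0 : EuclideanSpace ℝ (Fin 3)) a, ‖w s y‖ₑ ^ (3 : ℕ) ≤ M)
    (hD : ∀ a : ℝ, 0 < a → cknD a (0 : ℝ × EuclideanSpace ℝ (Fin 3)) π ≤ D)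
    (hw3 : ∀ a : ℝ, 0 < a → MemLp (uncurry w) 3
      (volume.restrict (parabolicCylinder a (0 : ℝ × EuclideanSpace ℝ (Fin 3)))))
    (htop : ∀ φ : EuclideanSpace ℝ (Fin 3) → EuclideanSpace ℝ (Fin 3), ContDiff ℝ (⊤ : ℕ∞) φ →
      HasCompactSupport φ → ∀ ε : ℝ, 0 < ε → ∃ s₁ : ℝ, s₁ < 0 ∧
        ∀ᵐ s ∂(volume.restrict (Ioo s₁ 0)), |∫ y, ⟪w s y, φ y⟫| ≤ ε)
    {T : ℝ} (hT : 0 < T) :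
    ∃ s₀ ∈ Ioo (-T) 0, ∃ W : ℝ → EuclideanSpace ℝ (Fin 3) → EuclideanSpace ℝ (Fin 3),
      IsLocalLeraySolutionOn (-s₀) 1 (w s₀) W (fun t x => π (s₀ + t) x) ∧
      MemLp (w s₀) 3 volume ∧ IsWeaklyDivFree (w s₀) ∧
      (∀ φ : EuclideanSpace ℝ (Fin 3) → EuclideanSpace ℝ (Fin 3),
        FunctionSpaces.IsTestFunctionOn (⊤ : Opens (EuclideanSpace ℝ (Fin 3))) φ →
          Tendsto (fun t => ∫ x, ⟪W t x, φ x⟫) (𝓝[<] (-s₀)) (𝓝 0)) ∧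
      ((∀ᵐ z ∂(volume.restrict (Ioo 0 (-s₀) ×ˢ (univ : Set (EuclideanSpace ℝ (Fin 3))))),
          W z.1 z.2 = 0) →
        ∀ᵐ z ∂(volume.restrict (Ioo s₀ 0 ×ˢ (univ : Set (EuclideanSpace ℝ (Fin 3))))),
          w z.1 z.2 = 0) := by
  classical
  -- ## Step 0: the half-space solution and the good time `s₀`
  have hslab := isSuitableWeakSolutionOn_halfspace hw
  have hu3 := locallyIntegrableOn_cube_halfspace hw3
  have hab : Ioo (-(T + 1)) 0 ×ˢ (univ : Set (EuclideanSpace ℝ (Fin 3))) ⊆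
      (slab (EuclideanSpace ℝ (Fin 3)) (Iio 0) isOpen_Iio : Set _) := fun z hz =>
    mem_slab.2 (mem_prod.1 hz).1.2
  have hRC := SuitableRestart.ae_tendsto_lintegral_ball_sub_sq hslab hu3 hab
  have hDF := SuitableRestart.ae_isWeaklyDivFree_slice hslab hab
  have hL3 : ∀ᵐ s ∂(volume : Measure ℝ), s < 0 →
      MemLp (w s) 3 volume ∧ ∫⁻ y, ‖w s y‖ₑ ^ (3 : ℕ) ≤ M := by
    have h := (ae_restrict_iff' measurableSet_Iio).1 (ae_pressure_ae_eq_rieszPressure hw hM hD)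
    filter_upwards [h] with s hs hs0
    exact ⟨(hs hs0).1, (hs hs0).2.1⟩
  obtain ⟨s₀, hs₀I, hs₀RC, hs₀DF, hs₀L3⟩ : ∃ s₀ ∈ Ioo (-T) (-T / 2),
      (s₀ ∈ Ioo (-(T + 1)) 0 → ∃ S : Set ℝ, (∀ᵐ t ∂(volume : Measure ℝ), t ∈ S) ∧
        ∀ r : ℝ, Tendsto (fun t => ∫⁻ x in ball (0 : EuclideanSpace ℝ (Fin 3)) r,
          ‖w t x - w s₀ x‖ₑ ^ 2) (𝓝[Ioi s₀ ∩ S] s₀) (𝓝 0)) ∧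
      (s₀ ∈ Ioo (-(T + 1)) 0 → IsWeaklyDivFree (w s₀)) ∧
      (s₀ < 0 → MemLp (w s₀) 3 volume ∧ ∫⁻ y, ‖w s₀ y‖ₑ ^ (3 : ℕ) ≤ M) := by
    have h := (hRC.and hDF).and hL3
    obtain ⟨s₀, hs₀, h1⟩ := exists_mem_Ioo_of_ae h (by linarith : -T < -T / 2)
    exact ⟨s₀, hs₀, h1.1.1, h1.1.2, h1.2⟩
  have hs₀neg : s₀ < 0 := by linarith [hs₀I.2]
  have hs₀T : -T < s₀ := hs₀I.1
  have hs₀I' : s₀ ∈ Ioo (-(T + 1)) 0 := ⟨by linarith, hs₀neg⟩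
  obtain ⟨S, hSae, hS⟩ := hs₀RC hs₀I'
  have hdiv := hs₀DF hs₀I'
  obtain ⟨hw₀3, hw₀M⟩ := hs₀L3 hs₀neg
  set T₁ : ℝ := -s₀ with hT₁
  have hT₁pos : 0 < T₁ := by rw [hT₁]; linarith
  -- ## Step 1: the good set of times `𝒢 ⊆ S`
  set Gset : Set ℝ := {s | s < 0 → MemLp (w s) 3 volume ∧ ∫⁻ y, ‖w s y‖ₑ ^ (3 : ℕ) ≤ M} with hGset
  have hGae : ∀ᵐ s ∂(volume : Measure ℝ), s ∈ Gset := hL3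
  choose ψ hψ hψd using fun m : ℕ => exists_dense_seq_isTestFunctionOn ((m : ℝ) + 1)
  have hψs : ∀ m i, ContDiff ℝ (⊤ : ℕ∞) (ψ m i) := fun m i => (hψ m i).contDiff
  have hψc : ∀ m i, HasCompactSupport (ψ m i) := fun m i => (hψ m i).hasCompactSupport
  choose s₁ hs₁ hs₁ae using fun m i j : ℕ =>
    htop (ψ m i) (hψs m i) (hψc m i) (1 / ((j : ℝ) + 1)) (by positivity)
  set Vset : ℕ → ℕ → ℕ → Set ℝ := fun m i j =>
    {s | s ∈ Ioo (s₁ m i j) 0 → |∫ y, ⟪w s y, ψ m i y⟫| ≤ 1 / ((j : ℝ) + 1)} with hVset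
  have hVae : ∀ m i j, ∀ᵐ s ∂(volume : Measure ℝ), s ∈ Vset m i j := fun m i j =>
    (ae_restrict_iff' measurableSet_Ioo).1 (hs₁ae m i j)
  set 𝒢 : Set ℝ := S ∩ Gset ∩ {s | ∀ m i j, s ∈ Vset m i j} with h𝒢
  have h𝒢ae : ∀ᵐ s ∂(volume : Measure ℝ), s ∈ 𝒢 := by
    have h3 : ∀ᵐ s ∂(volume : Measure ℝ), ∀ m i j, s ∈ Vset m i j :=
      ae_all_iff.2 fun m => ae_all_iff.2 fun i => ae_all_iff.2 fun j => hVae m i j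
    filter_upwards [hSae, hGae, h3] with s h1 h2 h3
    exact ⟨⟨h1, h2⟩, h3⟩
  have h𝒢S : 𝒢 ⊆ S := fun s hs => hs.1.1
  -- good shifted times, a.e. in time and in space–time
  have hshift_ae : ∀ {P : ℝ → Prop}, (∀ᵐ s ∂(volume : Measure ℝ), P s) →
      ∀ᵐ t ∂(volume : Measure ℝ), P (s₀ + t) := fun h =>
    (measurePreserving_add_left volume s₀).quasiMeasurePreserving.ae h
  have hgood_t : ∀ᵐ t ∂(volume : Measure ℝ), s₀ + t ∈ 𝒢 := hshift_ae h𝒢ae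
  have hgood_z : ∀ᵐ z ∂(volume : Measure (ℝ × EuclideanSpace ℝ (Fin 3))), s₀ + z.1 ∈ 𝒢 := by
    rw [Measure.volume_eq_prod]
    exact Measure.quasiMeasurePreserving_fst.ae hgood_t
  -- ## Step 2: the representative
  set W : ℝ → EuclideanSpace ℝ (Fin 3) → EuclideanSpace ℝ (Fin 3) := fun t x =>
    if s₀ + t ∈ 𝒢 then w (s₀ + t) x else if t ≤ T₁ / 2 then w s₀ x else 0 with hW
  have hWgood : ∀ t, s₀ + t ∈ 𝒢 → W t = w (s₀ + t) := fun t ht => by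
    funext x; simp only [hW, if_pos ht]
  have hWbad₁ : ∀ t, s₀ + t ∉ 𝒢 → t ≤ T₁ / 2 → W t = w s₀ := fun t ht ht' => by
    funext x; simp only [hW, if_neg ht, if_pos ht']
  have hWbad₂ : ∀ t, s₀ + t ∉ 𝒢 → ¬t ≤ T₁ / 2 → W t = 0 := fun t ht ht' => by
    funext x; simp only [hW, if_neg ht, if_neg ht', Pi.zero_apply]
  have hWae : ∀ᵐ z ∂(volume : Measure (ℝ × EuclideanSpace ℝ (Fin 3))),
      W z.1 z.2 = w (s₀ + z.1) z.2 := by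
    filter_upwards [hgood_z] with z hz
    rw [hWgood z.1 hz]
  -- ## Step 3: the translated suitable solution and its weak gradient
  have hsub0 : (slab (EuclideanSpace ℝ (Fin 3)) (Ioo s₀ 0) isOpen_Ioo) ≤
      slab (EuclideanSpace ℝ (Fin 3)) (Iio 0) isOpen_Iio := slab_mono Ioo_subset_Iio_self
  have hshift : IsSuitableWeakSolutionOn (slab (EuclideanSpace ℝ (Fin 3)) (Ioo 0 T₁) isOpen_Ioo) 1 0
      (fun s y => w (s₀ + s) y) (fun s y => π (s₀ + s) y) := by
    have h := (hslab.of_le hsub0).timeShift s₀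
    rwa [sub_self, zero_sub] at h
  have hWsuit : IsSuitableWeakSolutionOn (slab (EuclideanSpace ℝ (Fin 3)) (Ioo 0 T₁) isOpen_Ioo) 1 0
      W (fun s y => π (s₀ + s) y) :=
    hshift.congr_ae (ae_restrict_of_ae (hWae.mono fun z hz => hz.symm))
      (Eventually.of_forall fun _ => rfl)
  obtain ⟨G₀, hG₀, hG₀b⟩ := exists_weakGradient_uniform_dissipation hw hM hD
  have hGshift : HasWeakSpatialGradientOn (slab (EuclideanSpace ℝ (Fin 3)) (Ioo 0 T₁) isOpen_Ioo)
      (fun s y => w (s₀ + s) y) (fun s y => G₀ (s₀ + s) y) := by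
    have h := (hG₀.mono hsub0).timeShift s₀
    rwa [sub_self, zero_sub] at h
  have hWG : HasWeakSpatialGradientOn (slab (EuclideanSpace ℝ (Fin 3)) (Ioo 0 T₁) isOpen_Ioo)
      W (fun s y => G₀ (s₀ + s) y) :=
    hGshift.congr_ae (ae_restrict_of_ae (hWae.mono fun z hz => hz.symm))
  -- time translation of lower integrals over boxes: `∫_{(0,T₁)×K} F(s₀+t, x) = ∫_{(s₀,0)×K} F`
  have hshiftInt : ∀ (K : Set (EuclideanSpace ℝ (Fin 3))) (F : ℝ × EuclideanSpace ℝ (Fin 3) → ℝ≥0∞),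
      ∫⁻ z in Ioo 0 T₁ ×ˢ K, F (s₀ + z.1, z.2) = ∫⁻ z in Ioo s₀ 0 ×ˢ K, F z := by
    intro K F
    have h := setLIntegral_prod_timeShift s₀ s₀ 0 K F
    rwa [sub_self, zero_sub] at h
  -- the a.e. equality `W = w(s₀ + ·)` in `‖·‖ₑ²` form on restricted measures
  have hWae_sq : ∀ (A : Set (ℝ × EuclideanSpace ℝ (Fin 3))),
      ∫⁻ z in A, ‖W z.1 z.2‖ₑ ^ 2 = ∫⁻ z in A, ‖w (s₀ + z.1) z.2‖ₑ ^ 2 := fun A =>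
    lintegral_congr_ae ((ae_restrict_of_ae hWae).mono fun z hz => by
      show ‖W z.1 z.2‖ₑ ^ 2 = ‖w (s₀ + z.1) z.2‖ₑ ^ 2
      rw [hz])
  -- ## Step 4: the local Leray structure
  have hLL : IsLocalLeraySolutionOn T₁ 1 (w s₀) W (fun t x => π (s₀ + t) x) := by
    refine ⟨hWsuit, fun K hK => ?_, fun K _ => ?_, fun R hR => ?_, ⟨_, hWG, fun R hR => ?_⟩,
      fun K hK => ?_, fun R hR => ?_⟩
    · -- `W ∈ L²((0,T₁) × K)`
      have e : ∫⁻ z in Ioo 0 T₁ ×ˢ K, ‖w (s₀ + z.1) z.2‖ₑ ^ 2 = ∫⁻ z in Ioo s₀ 0 ×ˢ K, ‖w z.1 z.2‖ₑ ^ 2 :=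
        hshiftInt K (fun z => ‖w z.1 z.2‖ₑ ^ 2)
      rw [hWae_sq, e]
      have h := lintegral_box_sq_lt_top hw hM hD hT₁pos hK.isBounded
      rwa [hT₁, neg_neg] at h
    · -- `π ∈ L^{3/2}((0,T₁) × K)`
      have e : ∫⁻ z in Ioo 0 T₁ ×ˢ K, ‖π (s₀ + z.1) z.2‖ₑ ^ (3 / 2 : ℝ) =
          ∫⁻ z in Ioo s₀ 0 ×ˢ K, ‖π z.1 z.2‖ₑ ^ (3 / 2 : ℝ) :=
        hshiftInt K (fun z => ‖π z.1 z.2‖ₑ ^ (3 / 2 : ℝ))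
      show ∫⁻ z in Ioo 0 T₁ ×ˢ K, ‖π (s₀ + z.1) z.2‖ₑ ^ (3 / 2 : ℝ) < ⊤
      rw [e]
      have h := lintegral_box_pressure_lt_top hw hM hD hT₁pos K
      rwa [hT₁, neg_neg] at h
    · -- uniformly local energy, a.e. in time
      obtain ⟨C, hC, hCae⟩ := exists_ae_forall_lintegral_ball_sq_le hw hM hD hR.le
      refine ⟨C.toNNReal, ?_⟩
      have h1 : ∀ᵐ t ∂(volume : Measure ℝ), s₀ + t < 0 →
          ∀ x₀ : EuclideanSpace ℝ (Fin 3), ∫⁻ x in ball x₀ R, ‖w (s₀ + t) x‖ₑ ^ 2 ≤ C :=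
        hshift_ae ((ae_restrict_iff' measurableSet_Iio).1 hCae)
      refine (ae_restrict_iff' measurableSet_Ioo).2 ?_
      filter_upwards [h1, hgood_t] with t ht htg htI x₀
      rw [hWgood t htg, ENNReal.coe_toNNReal hC]
      exact ht (by rw [hT₁] at htI; linarith [htI.2]) x₀
    · -- uniformly local dissipation
      obtain ⟨C, hC, hCb⟩ := hG₀b T hT R hR
      refine ⟨C.toNNReal, fun x₀ => ?_⟩
      have e : ∫⁻ z in Ioo 0 T₁ ×ˢ ball x₀ R, ENNReal.ofReal (frobeniusNormSq (G₀ (s₀ + z.1) z.2)) =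
          ∫⁻ z in Ioo s₀ 0 ×ˢ ball x₀ R, ENNReal.ofReal (frobeniusNormSq (G₀ z.1 z.2)) :=
        hshiftInt (ball x₀ R) (fun z => ENNReal.ofReal (frobeniusNormSq (G₀ z.1 z.2)))
      show ∫⁻ z in Ioo 0 T₁ ×ˢ ball x₀ R, ENNReal.ofReal (frobeniusNormSq (G₀ (s₀ + z.1) z.2)) ≤ C.toNNReal
      rw [ENNReal.coe_toNNReal hC, e]
      exact (lintegral_mono_set (prod_mono (Ioo_subset_Ioo hs₀T.le le_rfl) Subset.rfl)).trans (hCb x₀)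
    · -- the datum is attained strongly in `L²(K)`
      obtain ⟨r, hr⟩ := hK.isBounded.subset_ball (0 : EuclideanSpace ℝ (Fin 3))
      have hSr := hS r
      rw [ENNReal.tendsto_nhds_zero]
      intro ε hε
      have h1 : ∀ᶠ τ in 𝓝 s₀, τ ∈ Ioi s₀ ∩ S →
          ∫⁻ x in ball (0 : EuclideanSpace ℝ (Fin 3)) r, ‖w τ x - w s₀ x‖ₑ ^ 2 ≤ ε :=
        eventually_nhdsWithin_iff.1 ((ENNReal.tendsto_nhds_zero.1 hSr) ε hε)
      have hcont : Tendsto (fun t : ℝ => s₀ + t) (𝓝 0) (𝓝 s₀) := by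
        have h := (continuous_const_add s₀).tendsto (0 : ℝ)
        rwa [add_zero] at h
      have h2 : ∀ᶠ t in 𝓝 (0 : ℝ), s₀ + t ∈ Ioi s₀ ∩ S →
          ∫⁻ x in ball (0 : EuclideanSpace ℝ (Fin 3)) r, ‖w (s₀ + t) x - w s₀ x‖ₑ ^ 2 ≤ ε :=
        hcont.eventually h1
      have h3 : ∀ᶠ t in 𝓝 (0 : ℝ), t ≤ T₁ / 2 := Iic_mem_nhds (by positivity)
      refine eventually_nhdsWithin_iff.2 ?_
      filter_upwards [h2, h3] with t h2 h3 ht0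
      by_cases htg : s₀ + t ∈ 𝒢
      · rw [hWgood t htg]
        exact (lintegral_mono_set hr).trans (h2 ⟨by show s₀ < s₀ + t; linarith [mem_Ioi.1 ht0], h𝒢S htg⟩)
      · rw [hWbad₁ t htg h3]
        simp
    · -- decay at spatial infinity
      have h := tendsto_lintegral_box_sq_cocompact hw hM hD hT₁pos R
      rw [hT₁, neg_neg] at h
      refine h.congr fun x₀ => ?_
      have e : ∫⁻ z in Ioo 0 T₁ ×ˢ ball x₀ R, ‖w (s₀ + z.1) z.2‖ₑ ^ 2 =
          ∫⁻ z in Ioo s₀ 0 ×ˢ ball x₀ R, ‖w z.1 z.2‖ₑ ^ 2 :=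
        hshiftInt (ball x₀ R) (fun z => ‖w z.1 z.2‖ₑ ^ 2)
      rw [hWae_sq, e]
  refine ⟨s₀, ⟨hs₀T, hs₀neg⟩, W, hLL, hw₀3, hdiv, fun φ hφ => ?_, fun hzero => ?_⟩
  · -- ## Step 5: the pairings vanish at the final time
    -- a ball `B = B(0, m+1)` carrying the support of `φ`
    obtain ⟨r, hr⟩ := hφ.hasCompactSupport.isCompact.isBounded.subset_closedBall (0 : EuclideanSpace ℝ (Fin 3))
    obtain ⟨m, hm⟩ := exists_nat_ge r
    set B : Set (EuclideanSpace ℝ (Fin 3)) := ball (0 : EuclideanSpace ℝ (Fin 3)) ((m : ℝ) + 1) with hB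
    have hφB : tsupport φ ⊆ B := hr.trans (closedBall_subset_ball (by linarith))
    have hφ0 : ∀ x ∉ B, φ x = 0 := fun x hx => image_eq_zero_of_notMem_tsupport fun h => hx (hφB h)
    have hψ0 : ∀ i, ∀ x ∉ B, ψ m i x = 0 := fun i x hx =>
      image_eq_zero_of_notMem_tsupport fun h => hx ((hψ m i).tsupport_subset h)
    have hφ2 : MemLp φ 2 (volume.restrict B) :=
      (hφ.contDiff.continuous.memLp_of_hasCompactSupport hφ.hasCompactSupport).restrict B
    have hψ2 : ∀ i, MemLp (ψ m i) 2 (volume.restrict B) := fun i =>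
      ((hψ m i).contDiff.continuous.memLp_of_hasCompactSupport (hψ m i).hasCompactSupport).restrict B
    -- the `L²(B)` bound of good slices
    set Λ : ℝ≥0∞ := ENNReal.ofReal ((m : ℝ) + 1) *
      volume (ball (0 : EuclideanSpace ℝ (Fin 3)) 1) ^ (1 / 3 : ℝ) * ((M : ℝ≥0∞) ^ (1 / 3 : ℝ)) ^ 2 with hΛ
    have hΛfin : Λ ≠ ⊤ := ENNReal.mul_ne_top (ENNReal.mul_ne_top ENNReal.ofReal_ne_top
      (ENNReal.rpow_ne_top_of_nonneg (by norm_num) measure_ball_lt_top.ne))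
      (ENNReal.pow_ne_top (ENNReal.rpow_ne_top_of_nonneg (by norm_num) ENNReal.coe_ne_top))
    set Cm : ℝ := (Λ ^ (1 / 2 : ℝ)).toReal with hCm
    have hCm0 : 0 ≤ Cm := ENNReal.toReal_nonneg
    have hgoodL2 : ∀ s ∈ 𝒢, s < 0 → MemLp (w s) 2 (volume.restrict B) ∧ (eLpNorm (w s) 2 (volume.restrict B)).toReal ≤ Cm := by
      intro s hs hs0
      obtain ⟨h3, hle⟩ := hs.1.2 hs0
      have hsq : ∫⁻ x in B, ‖w s x‖ₑ ^ 2 ≤ Λ := by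
        refine (lintegral_ball_enorm_sq_le_of_memLp_three h3 0 (by positivity)).trans ?_
        rw [hΛ]
        gcongr
        rw [eLpNorm_three_eq_lintegral_cube_rpow]
        exact ENNReal.rpow_le_rpow hle (by norm_num)
      have hmem : MemLp (w s) 2 (volume.restrict B) :=
        memLp_two_restrict_of_lintegral_lt_top h3.1 (hsq.trans_lt hΛfin.lt_top)
      refine ⟨hmem, ?_⟩
      rw [hCm, FunctionSpaces.AubinLions.eLpNorm_two_eq_rpow]
      exact ENNReal.toReal_mono (ENNReal.rpow_ne_top_of_nonneg (by norm_num) hΛfin)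
        (ENNReal.rpow_le_rpow hsq (by norm_num))
    -- whole-space pairings of fields vanishing off `B` are pairings on `B`
    have hpairB : ∀ {v g : EuclideanSpace ℝ (Fin 3) → EuclideanSpace ℝ (Fin 3)},
        (∀ x ∉ B, g x = 0) → ∫ y, ⟪v y, g y⟫ = ∫ y in B, ⟪v y, g y⟫ := by
      intro v g hg
      exact (setIntegral_eq_integral_of_forall_compl_eq_zero fun x hx => by
        rw [hg x hx, inner_zero_right]).symm
    rw [Metric.tendsto_nhds]
    intro ε hε
    -- the approximating test field `ψ m i` and the accuracy index `j`
    set δ : ℝ := ε / (4 * (Cm + 1)) with hδ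
    have hδpos : 0 < δ := by positivity
    obtain ⟨i, hi⟩ := hψd m φ hφ2 (ENNReal.ofReal δ) (ENNReal.ofReal_pos.2 hδpos).ne'
    have hi' : (eLpNorm (φ - ψ m i) 2 (volume.restrict B)).toReal ≤ δ := ENNReal.toReal_le_of_le_ofReal hδpos.le hi
    obtain ⟨j, hj⟩ := exists_nat_one_div_lt (half_pos hε)
    -- eventually: `t > T₁/2`, `t < T₁`, `s₀ + t > s₁`
    have hτ : s₁ m i j - s₀ < T₁ := by rw [hT₁]; linarith [hs₁ m i j]
    have h1 : ∀ᶠ t in 𝓝[<] T₁, T₁ / 2 < t := mem_nhdsWithin_of_mem_nhds (Ioi_mem_nhds (by linarith))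
    have h2 : ∀ᶠ t in 𝓝[<] T₁, s₁ m i j - s₀ < t := mem_nhdsWithin_of_mem_nhds (Ioi_mem_nhds hτ)
    have h3 : ∀ᶠ t in 𝓝[<] T₁, t < T₁ := self_mem_nhdsWithin
    filter_upwards [h1, h2, h3] with t ht1 ht2 ht3
    rw [Real.dist_eq, sub_zero]
    by_cases htg : s₀ + t ∈ 𝒢
    · -- good time: `W t = w(s₀ + t)`
      rw [hWgood t htg]
      set s : ℝ := s₀ + t with hs
      have hs0 : s < 0 := by rw [hs]; linarith
      have hsI : s ∈ Ioo (s₁ m i j) 0 := ⟨by rw [hs]; linarith, hs0⟩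
      obtain ⟨hv2, hvb⟩ := hgoodL2 s htg hs0
      have hV : |∫ y, ⟪w s y, ψ m i y⟫| ≤ 1 / ((j : ℝ) + 1) := htg.2 m i j hsI
      -- split `φ = ψ + (φ - ψ)` on `B`
      have hI1 : Integrable (fun y => ⟪w s y, φ y⟫) (volume.restrict B) := integrable_real_inner_of_memLp_two hv2 hφ2
      have hI2 : Integrable (fun y => ⟪w s y, ψ m i y⟫) (volume.restrict B) := integrable_real_inner_of_memLp_two hv2 (hψ2 i)
      have e1 : ∫ y, ⟪w s y, φ y⟫ = (∫ y in B, ⟪w s y, ψ m i y⟫) + ∫ y in B, ⟪w s y, φ y - ψ m i y⟫ := by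
        rw [hpairB hφ0, ← integral_add hI2 (hI1.sub hI2 |>.congr (Eventually.of_forall fun y => by
          simp only [Pi.sub_apply, inner_sub_right]))]
        refine integral_congr_ae (Eventually.of_forall fun y => ?_)
        simp only [inner_sub_right]
        ring
      have e2 : ∫ y, ⟪w s y, ψ m i y⟫ = ∫ y in B, ⟪w s y, ψ m i y⟫ := hpairB (hψ0 i)
      have hCS : |∫ y in B, ⟪w s y, φ y - ψ m i y⟫| ≤ Cm * δ := by
        refine (abs_integral_inner_le_of_memLp_two hv2 (hφ2.sub (hψ2 i))).trans ?_
        exact mul_le_mul hvb hi' ENNReal.toReal_nonneg hCm0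
      have hCmδ : Cm * δ ≤ ε / 4 := by
        rw [hδ, mul_div_assoc', div_le_div_iff₀ (by positivity) (by positivity)]
        nlinarith
      rw [e1, ← e2]
      calc |(∫ y, ⟪w s y, ψ m i y⟫) + ∫ y in B, ⟪w s y, φ y - ψ m i y⟫|
          ≤ |∫ y, ⟪w s y, ψ m i y⟫| + |∫ y in B, ⟪w s y, φ y - ψ m i y⟫| := abs_add_le _ _
        _ ≤ 1 / ((j : ℝ) + 1) + ε / 4 := add_le_add hV (hCS.trans hCmδ)
        _ < ε := by linarith
    · -- exceptional time in the second half: `W t = 0`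
      rw [hWbad₂ t htg (not_le.2 ht1)]
      simpa using hε
  · -- ## Step 6: `W = 0` a.e. on the strip forces `w = 0` a.e. on `]s₀, 0[ × ℝ³`
    have h1 : ∀ᵐ z ∂(volume.restrict (Ioo 0 T₁ ×ˢ (univ : Set (EuclideanSpace ℝ (Fin 3))))),
        w (s₀ + z.1) z.2 = 0 := by
      filter_upwards [hzero, ae_restrict_of_ae hWae] with z hz hz'
      rw [← hz', hz]
    have hmp := measurePreserving_timeShift_restrict (E := EuclideanSpace ℝ (Fin 3)) (-s₀) s₀ 0
      (univ : Set (EuclideanSpace ℝ (Fin 3)))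
    rw [add_neg_cancel, zero_add] at hmp
    have h2 := hmp.quasiMeasurePreserving.ae h1
    filter_upwards [h2] with z hz
    have hz' : w (s₀ + (z.1 + -s₀)) z.2 = 0 := hz
    have e : s₀ + (z.1 + -s₀) = z.1 := by ring
    rwa [e] at hz'

end ESSBlowup

end Literature.Analysis.FluidPDE
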